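import Summits.Ventures.PercRepro.S1PoorCapNullityTwo
import Summits.Ventures.PercRepro.S1PoorCapTable

/-!
# PercRepro — A PLANE-POOR 8-SPREAD MATROID OF NULLITY `3` HAS AT MOST `9` FOUR-CIRCUITS (p1, gen 34)

`proofs/P1-S2-CORANK6.md` §4o. The deletion recursion bounds the four-circuits of a plane-poor 8-spread matroid of
nullity `3` by `t(3) + t(2) + t(1) = 5 + 4 + 1 = 10`; the true maximum is smaller, and ONE unit of slack is what
the `(13, 6)` cell needs. Delete a point `x` of a four-circuit: if `x` lies on `≤ 4` four-circuits the recursion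
gives `4 + 5 = 9`. Otherwise `x` lies on `5`, and the nullity-`2` matroid `N ＼ {x}` is examined: if some point `y`
of one of its four-circuits lies on `≤ 3` of them, the count is `5 + 3 + 1 = 9`; if `y` lies on `4`, three of them
span a 5-point plane `Q ∌ x` (`S1PoorCapNullityTwo`), and a point `x ∉ Q` of a plane-poor matroid of nullity `3` lies
on at most `4` four-circuits (`ncard_fourCircuitsThrough_le_four_of_five_plane`: every four-circuit through `x`
has the same part `T` outside `Q`, and the parts inside `Q` are `≤ 4` by the plane of `T`) — a contradiction.
Hence **`ncard_fourCircuits_le_nine_of_nullity_three`**; the padded table `tPoorPad` (the proved rows `j ≤ 4`, the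
plain bound beyond) feeds the landed recursion at nullities `≤ 2`. Axioms: standard.
-/

open scoped Matroid

namespace PercRepro

namespace S1

open Set

variable {α : Type}

/-- **A point outside a 5-point plane of a plane-poor matroid of nullity `3` lies on at most `4` four-circuits.**
Every four-circuit `D ∋ x` has `r(Q ∪ D) + 3 ≤ |Q ∪ D|`, so every point outside `Q ∪ D` is a coloop and all the
four-circuits through `x` share the part `T = D ∖ Q`; then `|T| = 1` contradicts plane-poorness (the plane of
`D` contains `Q ∪ {x}`), `|T| = 4` gives one circuit, `|T| = 3` gives `≤ 2` (the extra point lies in `cl T`,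
a plane of `≤ 5` points), and `|T| = 2` gives `≤ 4`: the circuits inside the plane `P = cl D₀` are pairs of
`P ∩ Q` (`≤ 3` points), the others are pairs of `Q ∖ P`. -/
theorem ncard_fourCircuitsThrough_le_four_of_five_plane (N : Matroid α) [N.Finite] (hpp : PlanePoor N)
    (hd : N.E.encard = N.eRank + 3) {Q : Set α} (hQE : Q ⊆ N.E) (hQ5 : Q.ncard = 5) (hQr : N.eRk Q = 3)
    {x : α} (hx : x ∉ Q) : {D : Set α | N.IsCircuit D ∧ D.ncard = 4 ∧ x ∈ D}.ncard ≤ 4 := by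
  classical
  set F := {D : Set α | N.IsCircuit D ∧ D.ncard = 4 ∧ x ∈ D} with hF
  have hFfin : F.Finite := N.ground_finite.finite_subsets.subset (fun D hD => hD.1.subset_ground)
  have hQfin : Q.Finite := N.ground_finite.subset hQE
  by_cases hempty : F = ∅
  · rw [hempty, ncard_empty]; exact Nat.zero_le _
  obtain ⟨D₀, hD₀⟩ := nonempty_iff_ne_empty.2 hempty
  have hD₀4 : D₀.ncard = 4 := hD₀.2.1
  -- Step 1: every four-circuit through `x` lies in `Q ∪ D` for every four-circuit `D` through `x`
  have hstep : ∀ D ∈ F, ∀ D' ∈ F, D' ⊆ Q ∪ D := by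
    rintro D ⟨hD, hD4, hxD⟩ D' ⟨hD', -, -⟩
    have h1 : Q.encard = N.eRk Q + ((2 : ℕ) : ℕ∞) := by
      rw [← hQfin.cast_ncard_eq, hQ5, hQr]; rfl
    have h2 : D.encard = N.eRk D + ((1 : ℕ) : ℕ∞) := by rw [← hD.eRk_add_one_eq]; rfl
    have h3 : (Q ∩ D).encard ≤ N.eRk (Q ∩ D) + ((0 : ℕ) : ℕ∞) := by
      have hss : Q ∩ D ⊂ D := ⟨inter_subset_right, fun h => hx (h hxD).1⟩
      rw [(hD.ssubset_indep hss).eRk_eq_encard]; simp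
    have hnul := eRk_union_add_add_le_encard_add_of_nullity N hQE hD.subset_ground h1 h2 h3
    simp only [Nat.cast_zero, add_zero] at hnul
    have hnul' : N.eRk (Q ∪ D) + ((3 : ℕ) : ℕ∞) ≤ (Q ∪ D).encard := by
      have e : ((2 : ℕ) : ℕ∞) + ((1 : ℕ) : ℕ∞) = ((3 : ℕ) : ℕ∞) := by norm_num
      rw [← e, ← add_assoc]; exact hnul
    intro z hz
    by_contra hzU
    exact (isColoop_of_notMem_of_nullity_eq N (union_subset hQE hD.subset_ground) hnul' hd
      (hD'.subset_ground hz) hzU).notMem_isCircuit hD' hz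
  -- Step 2: the part outside `Q` is the same for all
  set T := D₀ \ Q with hT
  have hTeq : ∀ D ∈ F, D \ Q = T := by
    intro D hD
    apply Subset.antisymm
    · intro z hz
      rcases hstep D₀ hD₀ D hD hz.1 with h | h
      · exact absurd h hz.2
      · exact ⟨h, hz.2⟩
    · intro z hz
      rcases hstep D hD D₀ hD₀ hz.1 with h | h
      · exact absurd h hz.2
      · exact ⟨h, hz.2⟩
  have hxT : x ∈ T := ⟨hD₀.2.2, hx⟩
  have hD₀fin : D₀.Finite := finite_of_ncard_pos (by omega)
  have hTfin : T.Finite := hD₀fin.sdiff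
  have hTQ : Disjoint T Q := disjoint_sdiff_left
  have hTsub : T ⊆ N.E := fun z hz => hD₀.1.subset_ground hz.1
  -- every `D ∈ F` is `T ∪ (D ∩ Q)`, and `D ↦ D ∩ Q` is injective on `F`
  have hdecomp : ∀ D ∈ F, D = T ∪ (D ∩ Q) := by
    intro D hD
    rw [← hTeq D hD]
    ext z; simp only [mem_union, mem_sdiff, mem_inter_iff]; tauto
  have hinj : InjOn (fun D => D ∩ Q) F := by
    intro D hD D' hD' h
    simp only at h
    rw [hdecomp D hD, hdecomp D' hD', h]
  have hcount : F.ncard = ((fun D => D ∩ Q) '' F).ncard := (hinj.ncard_image).symm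
  have hTcard : T.ncard + (D₀ ∩ Q).ncard = 4 := by
    have := ncard_inter_add_ncard_sdiff_eq_ncard D₀ Q hD₀fin
    rw [hD₀4, ← hT] at this; omega
  have hTpos : 1 ≤ T.ncard := ncard_pos hTfin |>.2 ⟨x, hxT⟩
  have hTle : T.ncard ≤ 4 := by omega
  -- the images are subsets of `Q` of size `4 − |T|`
  have himg : ∀ D ∈ F, (D ∩ Q).ncard = 4 - T.ncard := by
    intro D hD
    have hD4 : D.ncard = 4 := hD.2.1
    have hDfin : D.Finite := finite_of_ncard_pos (by omega)
    have := ncard_inter_add_ncard_sdiff_eq_ncard D Q hDfin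
    rw [hD4, hTeq D hD] at this; omega
  rcases (by omega : T.ncard = 1 ∨ T.ncard = 2 ∨ T.ncard = 3 ∨ T.ncard = 4) with hT1 | hT2 | hT3 | hT4
  · -- `|T| = 1`: `T = {x}`, and the plane of `D₀` contains `Q ∪ {x}` — impossible
    exfalso
    have hTx : T = {x} := by
      symm; exact eq_of_subset_of_ncard_le (singleton_subset_iff.2 hxT) (by rw [ncard_singleton]; omega) hTfin
    have hS : D₀ ∩ Q ⊂ D₀ := ⟨inter_subset_left, fun h => hx (h hD₀.2.2).2⟩
    have hSind := hD₀.1.ssubset_indep hS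
    have hSr : N.eRk (D₀ ∩ Q) = 3 := by
      rw [hSind.eRk_eq_encard, ← (hD₀fin.subset inter_subset_left).cast_ncard_eq, himg D₀ hD₀, hT1]; rfl
    have hcl : N.closure (D₀ ∩ Q) = N.closure Q := by
      refine closure_eq_closure_of_subset_closure_of_eRk_le N
        (inter_subset_right.trans (N.subset_closure Q hQE)) ?_ (by rw [hSr]; exact ENat.coe_ne_top 3)
      rw [N.eRk_closure_eq, hQr, hSr]
    have hQcl : Q ⊆ N.closure D₀ := by
      refine (N.subset_closure Q hQE).trans ?_
      rw [← hcl]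
      exact N.closure_subset_closure inter_subset_left
    have hxcl : x ∈ N.closure D₀ := N.subset_closure D₀ hD₀.1.subset_ground hD₀.2.2
    have h6 : insert x Q ⊆ N.closure D₀ := insert_subset hxcl hQcl
    have := ncard_le_ncard h6 (N.ground_finite.subset (N.closure_subset_ground D₀))
    rw [ncard_insert_of_notMem hx hQfin, hQ5] at this
    have := hpp D₀ hD₀.1 hD₀.2.1
    omega
  · -- `|T| = 2`: the plane `P = cl D₀` argument
    set P := N.closure D₀ with hP
    have hPE : P ⊆ N.E := N.closure_subset_ground D₀
    have hPfin : P.Finite := N.ground_finite.subset hPE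
    have hP5 : P.ncard ≤ 5 := hpp D₀ hD₀.1 hD₀.2.1
    have hTP : T ⊆ P := fun z hz => N.subset_closure D₀ hD₀.1.subset_ground hz.1
    have hPr : N.eRk P = 3 := eRk_closure_fourCircuit N hD₀.1 hD₀.2.1
    -- `|P ∩ Q| ≤ 3`
    have hPQ : (P ∩ Q).ncard ≤ 3 := by
      have hdisj : Disjoint T (P ∩ Q) := hTQ.mono_right inter_subset_right
      have hsub : T ∪ (P ∩ Q) ⊆ P := union_subset hTP inter_subset_left
      have := ncard_le_ncard hsub hPfin
      rw [ncard_union_eq hdisj hTfin (hPfin.subset inter_subset_left)] at this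
      omega
    -- a circuit meeting `P ∩ Q` lies in `P`
    have hinP : ∀ D ∈ F, ∀ c ∈ D ∩ Q, c ∈ P → D ⊆ P := by
      intro D hD c hc hcP
      have hD4 : D.ncard = 4 := hD.2.1
      have hDfin : D.Finite := finite_of_ncard_pos (by omega)
      have hTc : insert c T ⊆ D := by
        refine insert_subset hc.1 ?_
        rw [← hTeq D hD]; exact sdiff_subset
      have hcT : c ∉ T := fun h => hTQ.notMem_of_mem_left h hc.2
      have hss : insert c T ⊂ D := by
        refine ⟨hTc, fun h => ?_⟩
        have h1 := ncard_le_ncard h ((finite_insert.2 hTfin))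
        rw [ncard_insert_of_notMem hcT hTfin, hT2, hD4] at h1
        omega
      have hind := hD.1.ssubset_indep hss
      have hr3 : N.eRk (insert c T) = 3 := by
        rw [hind.eRk_eq_encard, ← (finite_insert.2 hTfin).cast_ncard_eq, ncard_insert_of_notMem hcT hTfin, hT2]; rfl
      have hcl : N.closure (insert c T) = P := by
        refine closure_eq_closure_of_subset_closure_of_eRk_le N (insert_subset hcP hTP) ?_
          (by rw [hr3]; exact ENat.coe_ne_top 3)
        rw [N.eRk_closure_eq, hr3]
        have h3' := eRk_closure_fourCircuit N hD₀.1 hD₀4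
        rw [N.eRk_closure_eq] at h3'
        rw [h3']
      intro z hz
      by_cases hzT : z ∈ insert c T
      · rw [← hcl]; exact N.subset_closure _ (hind.subset_ground) hzT
      · have hzcl := hD.1.mem_closure_sdiff_singleton_of_mem hz
        have hsub : D \ {z} ⊆ insert c T := by
          intro w hw
          by_contra hwT
          -- `D` would have `≥ 5` points: `insert c T`, `z`, `w`
          have h5 : insert z (insert w (insert c T)) ⊆ D := by
            refine insert_subset hz (insert_subset hw.1 hTc)
          have hzw : z ≠ w := fun h => hw.2 (mem_singleton_iff.2 h.symm)
          have hzn : z ∉ insert w (insert c T) := by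
            simp only [mem_insert_iff, not_or]; exact ⟨hzw, fun h => hzT (by simp [h]), fun h => hzT (by simp [h])⟩
          have h1 := ncard_le_ncard h5 hDfin
          rw [ncard_insert_of_notMem hzn ((finite_insert.2 (finite_insert.2 hTfin))),
            ncard_insert_of_notMem hwT (finite_insert.2 hTfin), ncard_insert_of_notMem hcT hTfin, hT2,
            hD4] at h1
          omega
        rw [← hcl]
        exact N.closure_subset_closure hsub hzcl
    -- split `F` by `D ⊆ P`
    set F₁ := {D ∈ F | D ⊆ P} with hF₁
    set F₂ := {D ∈ F | ¬ D ⊆ P} with hF₂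
    have hsplit : F = F₁ ∪ F₂ := by
      ext D; simp only [hF₁, hF₂, mem_union, mem_setOf_eq]; tauto
    have hF₁fin : F₁.Finite := hFfin.subset (fun D hD => hD.1)
    have hF₂fin : F₂.Finite := hFfin.subset (fun D hD => hD.1)
    -- `F₁` injects into the 2-subsets of `P ∩ Q`
    have hF₁le : F₁.ncard ≤ (P ∩ Q).ncard.choose 2 := by
      have himg₁ : (fun D => D ∩ Q) '' F₁ ⊆ {S : Set α | S ⊆ P ∩ Q ∧ S.ncard = 2} := by
        rintro S ⟨D, hD, rfl⟩
        refine ⟨fun z hz => ⟨hD.2 hz.1, hz.2⟩, ?_⟩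
        rw [himg D hD.1, hT2]
      have := ncard_le_ncard himg₁ ((hPfin.subset inter_subset_left).finite_subsets.subset (fun S hS => hS.1))
      rw [ncard_subsets_eq_choose _ (hPfin.subset inter_subset_left)] at this
      rw [← (hinj.mono (fun D hD => hD.1)).ncard_image]
      exact this
    -- `F₂` injects into the 2-subsets of `Q ∖ P`
    have hF₂le : F₂.ncard ≤ (Q \ P).ncard.choose 2 := by
      have himg₂ : (fun D => D ∩ Q) '' F₂ ⊆ {S : Set α | S ⊆ Q \ P ∧ S.ncard = 2} := by
        rintro S ⟨D, hD, rfl⟩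
        refine ⟨fun z hz => ⟨hz.2, fun hzP => hD.2 (hinP D hD.1 z hz hzP)⟩, ?_⟩
        rw [himg D hD.1, hT2]
      have := ncard_le_ncard himg₂ ((hQfin.sdiff).finite_subsets.subset (fun S hS => hS.1))
      rw [ncard_subsets_eq_choose _ hQfin.sdiff] at this
      rw [← (hinj.mono (fun D hD => hD.1)).ncard_image]
      exact this
    have hQsplit : (P ∩ Q).ncard + (Q \ P).ncard = 5 := by
      have := ncard_inter_add_ncard_sdiff_eq_ncard Q P hQfin
      rw [inter_comm] at this; omega
    have hF₁Q : 2 ≤ (P ∩ Q).ncard := by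
      have hsub : D₀ ∩ Q ⊆ P ∩ Q := fun z hz => ⟨N.subset_closure D₀ hD₀.1.subset_ground hz.1, hz.2⟩
      have := ncard_le_ncard hsub (hPfin.subset inter_subset_left)
      rw [himg D₀ hD₀, hT2] at this; exact this
    have htot : F.ncard ≤ F₁.ncard + F₂.ncard := by
      rw [hsplit]; exact ncard_union_le _ _
    rcases (by omega : (P ∩ Q).ncard = 2 ∨ (P ∩ Q).ncard = 3) with h2 | h3
    · have h3' : (Q \ P).ncard = 3 := by omega
      rw [h2] at hF₁le; rw [h3'] at hF₂le
      have : Nat.choose 2 2 = 1 := by decide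
      have : Nat.choose 3 2 = 3 := by decide
      omega
    · have h2' : (Q \ P).ncard = 2 := by omega
      rw [h3] at hF₁le; rw [h2'] at hF₂le
      have : Nat.choose 3 2 = 3 := by decide
      have : Nat.choose 2 2 = 1 := by decide
      omega
  · -- `|T| = 3`: the extra point lies in the plane `cl T ⊆ cl D₀` of `≤ 5` points
    have hcl : N.closure T ⊆ N.closure D₀ := N.closure_subset_closure sdiff_subset
    have hP5 : (N.closure D₀).ncard ≤ 5 := hpp D₀ hD₀.1 hD₀.2.1
    have hPfin : (N.closure D₀).Finite := N.ground_finite.subset (N.closure_subset_ground D₀)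
    have hTP : T ⊆ N.closure D₀ := fun z hz => N.subset_closure D₀ hD₀.1.subset_ground hz.1
    have himg₃ : (fun D => D ∩ Q) '' F ⊆ {S : Set α | S ⊆ N.closure D₀ \ T ∧ S.ncard = 1} := by
      rintro S ⟨D, hD, rfl⟩
      have hD4 : D.ncard = 4 := hD.2.1
      have hDfin : D.Finite := finite_of_ncard_pos (by omega)
      refine ⟨?_, by rw [himg D hD, hT3]⟩
      intro a ha
      refine ⟨?_, fun haT => hTQ.notMem_of_mem_left haT ha.2⟩
      -- `a ∈ cl T`: `D = insert a T` is a circuit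
      have hDeq : D = insert a T := by
        have h1 := hdecomp D hD
        have hS1 : (D ∩ Q) = {a} := by
          symm
          exact eq_of_subset_of_ncard_le (singleton_subset_iff.2 ha)
            (by rw [ncard_singleton, himg D hD, hT3]) (hDfin.subset inter_subset_left)
        rw [h1, hS1, union_singleton]
      have haT : a ∉ T := fun h => hTQ.notMem_of_mem_left h ha.2
      have hacl := hD.1.mem_closure_sdiff_singleton_of_mem (hDeq ▸ mem_insert a T)
      rw [hDeq, insert_sdiff_of_mem _ (mem_singleton a), sdiff_singleton_eq_self haT] at hacl
      exact hcl hacl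
    have := ncard_le_ncard himg₃ ((hPfin.sdiff).finite_subsets.subset (fun S hS => hS.1))
    rw [ncard_subsets_eq_choose _ hPfin.sdiff, Nat.choose_one_right] at this
    have hdiff : (N.closure D₀ \ T).ncard + T.ncard = (N.closure D₀).ncard := by
      have := ncard_inter_add_ncard_sdiff_eq_ncard (N.closure D₀) T hPfin
      rw [inter_eq_right.2 hTP] at this; omega
    rw [hcount]
    omega
  · -- `|T| = 4`: every circuit through `x` is `T`
    have hF : F ⊆ {T} := by
      intro D hD
      have hD4 : D.ncard = 4 := hD.2.1
      have hDfin : D.Finite := finite_of_ncard_pos (by omega)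
      rw [mem_singleton_iff, hdecomp D hD]
      have : (D ∩ Q) = ∅ := by
        rw [← ncard_eq_zero (hDfin.subset inter_subset_left), himg D hD, hT4]
      rw [this, union_empty]
    exact (ncard_le_ncard hF (finite_singleton T)).trans (by rw [ncard_singleton]; norm_num)

/-- **The plane-poor table, padded beyond nullity `4` by the plain bound** `C(j + 2, 3)`: a table valid at every nullity. -/
def tPoorPad (j : ℕ) : ℕ := if j ≤ 4 then tPoor j else (j + 2).choose 3

/-- **The padded table holds at every nullity** on the plane-poor 8-spread class (`tPoor_of_le_four` below `5`, the plain
bound `ncard_fourCircuitsThrough_le_choose` above). -/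
theorem tPoorPad_table (N : Matroid α) [N.Finite] (hpp : PlanePoor N) (hN8 : Spread8 N) (j : ℕ)
    (hd : N.E.encard = N.eRank + j) (f : α) (_hf : f ∈ N.E) :
    {D : Set α | N.IsCircuit D ∧ D.ncard = 4 ∧ f ∈ D}.ncard ≤ tPoorPad j := by
  unfold tPoorPad
  split_ifs with hj
  · exact tPoor_of_le_four N hpp hN8 hj hd f
  · exact ncard_fourCircuitsThrough_le_choose N hd f

/-- `Σ_{j ≤ 1} tPoorPad j = 1`. -/
theorem capSum_tPoorPad_one : capSum tPoorPad 1 = 1 := by decide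

/-- `Σ_{j ≤ 2} tPoorPad j = 5`. -/
theorem capSum_tPoorPad_two : capSum tPoorPad 2 = 5 := by decide

/-- **The four-circuits of a plane-poor 8-spread matroid of nullity `≤ 2`**: at most `capSum tPoorPad d` (`1` at nullity `1`,
`5` at nullity `2`), by the landed recursion. -/
theorem ncard_fourCircuits_le_capSum_tPoorPad (N : Matroid α) [N.Finite] (hpp : PlanePoor N) (hN8 : Spread8 N) {d : ℕ}
    (hd : N.E.encard = N.eRank + d) : {D : Set α | N.IsCircuit D ∧ D.ncard = 4}.ncard ≤ capSum tPoorPad d :=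
  ncard_fourCircuits_le_capSum_of_planePoor N hpp hN8 hd tPoorPad
    (fun N' _ hpp' hN8' j hj f hf => tPoorPad_table N' hpp' hN8' j hj f hf)

/-- The four-circuits of a finite matroid form a finite set. -/
theorem fourCircuits_finite (N : Matroid α) [N.Finite] : {D : Set α | N.IsCircuit D ∧ D.ncard = 4}.Finite :=
  N.ground_finite.finite_subsets.subset (fun _ hD => hD.1.subset_ground)

/-- **A PLANE-POOR 8-SPREAD MATROID OF NULLITY `3` HAS AT MOST `9` FOUR-CIRCUITS.** Delete a point `x` of a four-circuit:
`#4circ(N) ≤ d(x) + #4circ(N ＼ x)` with `d(x) ≤ 5` and `#4circ(N ＼ x) ≤ 5`; if `d(x) ≤ 4` we are done; else delete a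
point `y` of a four-circuit of `N ＼ x` (nullity `2`): `#4circ(N ＼ x) ≤ d'(y) + 1`, so `d'(y) ≤ 3` suffices — and `d'(y) = 4`
produces a 5-point plane `Q ∌ x` in `N`, against `d(x) = 5` (`ncard_fourCircuitsThrough_le_four_of_five_plane`). -/
theorem ncard_fourCircuits_le_nine_of_nullity_three (N : Matroid α) [N.Finite] (hpp : PlanePoor N) (hN8 : Spread8 N)
    (hd : N.E.encard = N.eRank + 3) : {D : Set α | N.IsCircuit D ∧ D.ncard = 4}.ncard ≤ 9 := by
  classical
  by_cases hempty : {D : Set α | N.IsCircuit D ∧ D.ncard = 4} = ∅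
  · rw [hempty, ncard_empty]; omega
  obtain ⟨D₀, hD₀⟩ := nonempty_iff_ne_empty.2 hempty
  have hD₀4 : D₀.ncard = 4 := hD₀.2
  obtain ⟨x, hx⟩ : D₀.Nonempty := nonempty_of_ncard_ne_zero (by omega)
  have hxE : x ∈ N.E := hD₀.1.subset_ground hx
  have hxnc : ¬ N.IsColoop x := fun h => h.notMem_isCircuit hD₀.1 hx
  have hd' : (N ＼ {x}).E.encard = (N ＼ {x}).eRank + 2 :=
    nullity_delete_singleton_of_not_isColoop N hxE hxnc (d := 2) (by rw [hd]; norm_num)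
  have hsplit := ncard_fourCircuits_le_through_add_delete N x
  have hx5 := tPoor_three N hpp hN8 hd x
  have hpp' := planePoor_delete N hpp x
  have hN8' := spread8_delete N hN8 x
  have htot2 : {D : Set α | (N ＼ {x}).IsCircuit D ∧ D.ncard = 4}.ncard ≤ 5 := by
    have := ncard_fourCircuits_le_capSum_tPoorPad (N ＼ {x}) hpp' hN8' hd'
    rwa [capSum_tPoorPad_two] at this
  by_cases hx4 : {D : Set α | N.IsCircuit D ∧ D.ncard = 4 ∧ x ∈ D}.ncard ≤ 4
  · omega
  push Not at hx4
  by_cases hempty' : {D : Set α | (N ＼ {x}).IsCircuit D ∧ D.ncard = 4} = ∅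
  · rw [hempty', ncard_empty] at hsplit; omega
  obtain ⟨D₁, hD₁⟩ := nonempty_iff_ne_empty.2 hempty'
  have hD₁4 : D₁.ncard = 4 := hD₁.2
  obtain ⟨y, hy⟩ : D₁.Nonempty := nonempty_of_ncard_ne_zero (by omega)
  have hyE' : y ∈ (N ＼ {x}).E := hD₁.1.subset_ground hy
  have hync : ¬ (N ＼ {x}).IsColoop y := fun h => h.notMem_isCircuit hD₁.1 hy
  have hd'' : (N ＼ {x} ＼ {y}).E.encard = (N ＼ {x} ＼ {y}).eRank + 1 :=
    nullity_delete_singleton_of_not_isColoop (N ＼ {x}) hyE' hync (d := 1) (by rw [hd']; norm_num)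
  have hsplit' := ncard_fourCircuits_le_through_add_delete (N ＼ {x}) y
  have htot1 : {D : Set α | (N ＼ {x} ＼ {y}).IsCircuit D ∧ D.ncard = 4}.ncard ≤ 1 := by
    have := ncard_fourCircuits_le_capSum_tPoorPad (N ＼ {x} ＼ {y}) (planePoor_delete _ hpp' y) (spread8_delete _ hN8' y) hd''
    rwa [capSum_tPoorPad_one] at this
  by_cases hy3 : {D : Set α | (N ＼ {x}).IsCircuit D ∧ D.ncard = 4 ∧ y ∈ D}.ncard ≤ 3
  · omega
  push Not at hy3
  have hfin : {D : Set α | (N ＼ {x}).IsCircuit D ∧ D.ncard = 4 ∧ y ∈ D}.Finite :=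
    (N ＼ {x}).ground_finite.finite_subsets.subset (fun D hD => hD.1.subset_ground)
  obtain ⟨E₁, E₂, E₃, h1, h2, h3, h12, h13, h23⟩ := (two_lt_ncard_iff hfin).1 (by omega)
  obtain ⟨Q, hQE', hQ5, hQr'⟩ := exists_five_plane_of_three_fourCircuits (N ＼ {x}) hd' h1.1 h1.2.1 h2.1 h2.2.1
    h3.1 h3.2.1 h12 h13 h23 h1.2.2 h2.2.2 h3.2.2
  rw [Matroid.delete_ground] at hQE'
  have hQE : Q ⊆ N.E := hQE'.trans sdiff_subset
  have hxQ : x ∉ Q := fun h => (hQE' h).2 (mem_singleton x)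
  have hQr : N.eRk Q = 3 := by
    rw [Matroid.delete_eq_restrict, Matroid.restrict_eRk_eq N hQE'] at hQr'
    exact hQr'
  have := ncard_fourCircuitsThrough_le_four_of_five_plane N hpp hd hQE hQ5 hQr hxQ
  omega

end S1

end PercRepro
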